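import Literature.AnabelianGeometry.AbsoluteAnabelian.AbsTopII.EllipticCuspidalizationComparisonPrime
import HarnessLib

/-!
# [AbsTopII] Cor 3.3 (i′)(ii′)(iii′) over the datum: MODEL-INDEPENDENCE at a fixed class (kernel)
# and first consequences — proof-only companion of `EllipticCuspidalizationComparisonPrime.lean`

S. Mochizuki, *Topics in Absolute Anabelian Geometry II* [AbsTopII] (bib `MochizukiAbsTopII2013`;
kurims manuscript `paper:url-585b8d0ad0d9`), §3, Cor 3.3 pp. 67–69.

abc-iut row «COR33-RETYPE» (abc-iut-L4-lead RULING #6l; seat abc-iut-L4-t4).  abc-iut-f-067's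
acceptance test for the repair of finding F-f067-1 (STATUS 08:33:42Z): "MODEL-INDEPENDENCE AT A
FIXED DATUM — `Cor_3_3_x′` PASSES clause-wise iff its truth value at fixed `𝒟` is determined by `𝒟`
plus `Prop`-valued primitive flags on datum objects".  PROVED here, in kernel:

* `EllipticDatumModel.ext_of_flags` — a model over `𝒟` is DETERMINED by its cusps and its four
  `Prop`-valued flags (`IsFinEt`, `IsOpenImmersion`, `IsOncePuncturedElliptic`,
  `IsEllipticallyAdmissible`): two models agreeing on them are EQUAL (the laws are proofs); hence
  `cor_3_3_i′_iff_of_flags`, `cor_3_3_iii′_iff_of_flags` — (i′), (iii′) cannot flip between two models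
  with the same cusps and flags;
* `cor_3_3_ii′_iff_of_flags` — (ii′) does not even read the cusps: two models with equivalent flags
  `IsFinEt`, `IsOncePuncturedElliptic`, `IsEllipticallyAdmissible` have EQUIVALENT `Cor_3_3_ii′`
  (contrast: p429178 `forall_cor_3_3_ii_iff_vacuous` flips the frozen `Cor_3_3_ii` by re-choosing the
  free field `doubleCovers`);
* `isOpen_of_mem_doubleCoverSubgroups` / `index_of_mem_doubleCoverSubgroups` — the datum's
  double-cover subgroups are open of index `2` (the law `isFinEt_injective`), so the equation of
  `Cor_3_3_ii′` is exactly: (⊆) "`Π_D ∩ Δ_C` is torsion-free for every double covering `D → C` by a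
  once-punctured elliptic curve" and (⊇) "every open index-`2` `J` with `J ∩ Δ_C` torsion-free arises
  from such a `D → C`" (`doubleCoverSubgroups_eq_iff`).

No definition, no named fact.  HONEST FRAMING: bookkeeping about OUR typing; nothing here bears on the
published corollary or on [IUTchIII] Cor 3.12.
-/

noncomputable section

open CategoryTheory Topology
open scoped Pointwise

universe u

namespace Literature.AnabelianGeometry.AbsoluteAnabelian.AbsTopII

open Literature.AlgebraicGeometry.Frobenioids (IsSlimGroup)
open FundamentalExtension
open AbsTopI (ConstructionDataClass)
open AugmentedProfiniteGrp

namespace EllipticDatumModel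

variable {𝒟 : ConstructionDataClass.{u}}

/-! ### Two bookkeeping lemmas of the statements -/

/-- Under the standing hypotheses `Π` is slim (abc-iut-L4-t4's `arith_slim_of_geom_slim_of_gal_slim`;
the term used inline by `Cor_3_3_i′` / `Cor_3_3_iii′` for the slimness input of `PiChain`).
[cite: MochizukiAbsTopII2013, Cor 3.3 p.67] -/
theorem IsCor33Member.arith_slim {M : EllipticDatumModel 𝒟} {b : 𝒟.Base} {X : (𝒟.datum b).Obj}
    (h : M.IsCor33Member b X) : IsSlimGroup ((𝒟.datum b).ext X).arith :=
  ((𝒟.datum b).ext X).arith_slim_of_geom_slim_of_gal_slim h.geom_slim h.slim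

/-- The setting's `Π_D` is one of the double-cover subgroups computed from the datum (so in (iii′)
"`Π_D` ranges over `doubleCoverSubgroups`"). [cite: MochizukiAbsTopII2013, Cor 3.3 (iii) p.68] -/
theorem Setting.PiD_mem {M : EllipticDatumModel 𝒟} {b : 𝒟.Base} {X C : (𝒟.datum b).Obj}
    {f : (𝒟.datum b).Hom X C} (s : M.Setting b X C f) : s.PiD ∈ M.doubleCoverSubgroups b C :=
  ⟨s.D, s.cover, s.coverHom, s.isFinEt_cover, s.isOncePuncturedElliptic, s.mk_coverHom, rfl,
    s.index_PiD⟩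

/-! ### A model is determined by its cusps and its flags -/

/-- **Model extensionality**: two models over the same class with the same cusps and the same four
`Prop`-valued flags are EQUAL (the remaining fields are proofs).  This is abc-iut-f-067's
model-independence test in its strongest form. [cite: MochizukiAbsTopII2013, Cor 3.3 pp.67-68] -/
theorem ext_of_flags {M₁ M₂ : EllipticDatumModel 𝒟} (hc : M₁.cusps = M₂.cusps)
    (hfin : ∀ (b : 𝒟.Base) (X Y : (𝒟.datum b).Obj) (f : (𝒟.datum b).Hom X Y),
      M₁.IsFinEt f ↔ M₂.IsFinEt f)
    (himm : ∀ (b : 𝒟.Base) (U X : (𝒟.datum b).Obj) (ι : (𝒟.datum b).Hom U X),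
      M₁.IsOpenImmersion ι ↔ M₂.IsOpenImmersion ι)
    (hell : ∀ (b : 𝒟.Base) (D : (𝒟.datum b).Obj),
      M₁.IsOncePuncturedElliptic b D ↔ M₂.IsOncePuncturedElliptic b D)
    (hadm : ∀ (b : 𝒟.Base) (X : (𝒟.datum b).Obj),
      M₁.IsEllipticallyAdmissible b X ↔ M₂.IsEllipticallyAdmissible b X) : M₁ = M₂ := by
  obtain ⟨c₁, F₁, hF₁, I₁, hI₁, E₁, A₁⟩ := M₁
  obtain ⟨c₂, F₂, hF₂, I₂, hI₂, E₂, A₂⟩ := M₂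
  dsimp only at hc hfin himm hell hadm
  subst hc
  have hF : @F₁ = @F₂ := by
    funext b X Y f
    exact propext (hfin b X Y f)
  have hI : @I₁ = @I₂ := by
    funext b U X ι
    exact propext (himm b U X ι)
  have hE : E₁ = E₂ := by
    funext b D
    exact propext (hell b D)
  have hA : A₁ = A₂ := by
    funext b X
    exact propext (hadm b X)
  subst hF hI hE hA
  rfl

/-- **(i′) is model-independent at a fixed datum**: same cusps and flags ⇒ equivalent `Cor_3_3_i′`.
[cite: MochizukiAbsTopII2013, Cor 3.3 (i) p.67] -/
theorem cor_3_3_i'_iff_of_flags {M₁ M₂ : EllipticDatumModel 𝒟} (hc : M₁.cusps = M₂.cusps)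
    (hfin : ∀ (b : 𝒟.Base) (X Y : (𝒟.datum b).Obj) (f : (𝒟.datum b).Hom X Y),
      M₁.IsFinEt f ↔ M₂.IsFinEt f)
    (himm : ∀ (b : 𝒟.Base) (U X : (𝒟.datum b).Obj) (ι : (𝒟.datum b).Hom U X),
      M₁.IsOpenImmersion ι ↔ M₂.IsOpenImmersion ι)
    (hell : ∀ (b : 𝒟.Base) (D : (𝒟.datum b).Obj),
      M₁.IsOncePuncturedElliptic b D ↔ M₂.IsOncePuncturedElliptic b D)
    (hadm : ∀ (b : 𝒟.Base) (X : (𝒟.datum b).Obj),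
      M₁.IsEllipticallyAdmissible b X ↔ M₂.IsEllipticallyAdmissible b X) :
    M₁.Cor_3_3_i' ↔ M₂.Cor_3_3_i' := by
  rw [ext_of_flags hc hfin himm hell hadm]

/-- **(iii′) is model-independent at a fixed datum**: same cusps and flags ⇒ equivalent
`Cor_3_3_iii′`. [cite: MochizukiAbsTopII2013, Cor 3.3 (iii) p.68] -/
theorem cor_3_3_iii'_iff_of_flags {M₁ M₂ : EllipticDatumModel 𝒟} (hc : M₁.cusps = M₂.cusps)
    (hfin : ∀ (b : 𝒟.Base) (X Y : (𝒟.datum b).Obj) (f : (𝒟.datum b).Hom X Y),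
      M₁.IsFinEt f ↔ M₂.IsFinEt f)
    (himm : ∀ (b : 𝒟.Base) (U X : (𝒟.datum b).Obj) (ι : (𝒟.datum b).Hom U X),
      M₁.IsOpenImmersion ι ↔ M₂.IsOpenImmersion ι)
    (hell : ∀ (b : 𝒟.Base) (D : (𝒟.datum b).Obj),
      M₁.IsOncePuncturedElliptic b D ↔ M₂.IsOncePuncturedElliptic b D)
    (hadm : ∀ (b : 𝒟.Base) (X : (𝒟.datum b).Obj),
      M₁.IsEllipticallyAdmissible b X ↔ M₂.IsEllipticallyAdmissible b X) :
    M₁.Cor_3_3_iii' ↔ M₂.Cor_3_3_iii' := by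
  rw [ext_of_flags hc hfin himm hell hadm]

/-! ### (ii′) does not read the cusps -/

/-- The standing hypotheses only read the flag `IsEllipticallyAdmissible`.
[cite: MochizukiAbsTopII2013, Cor 3.3 p.67] -/
theorem isCor33Member_iff_of_flags {M₁ M₂ : EllipticDatumModel 𝒟}
    (hadm : ∀ (b : 𝒟.Base) (X : (𝒟.datum b).Obj),
      M₁.IsEllipticallyAdmissible b X ↔ M₂.IsEllipticallyAdmissible b X)
    (b : 𝒟.Base) (X : (𝒟.datum b).Obj) : M₁.IsCor33Member b X ↔ M₂.IsCor33Member b X :=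
  ⟨fun h => ⟨h.mem, (hadm b X).1 h.ellipticallyAdmissible, h.slim, h.cyclotomic, h.geom_slim,
      h.geom_ne_bot⟩,
    fun h => ⟨h.mem, (hadm b X).2 h.ellipticallyAdmissible, h.slim, h.cyclotomic, h.geom_slim,
      h.geom_ne_bot⟩⟩

/-- `KIsogenous` only reads the flag `IsFinEt`. [cite: MochizukiAbsTopII2013, Def 3.1 (a) p.65] -/
theorem kIsogenous_iff_of_flags {M₁ M₂ : EllipticDatumModel 𝒟}
    (hfin : ∀ (b : 𝒟.Base) (X Y : (𝒟.datum b).Obj) (f : (𝒟.datum b).Hom X Y),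
      M₁.IsFinEt f ↔ M₂.IsFinEt f)
    (b : 𝒟.Base) (X₁ X₂ : (𝒟.datum b).Obj) : M₁.KIsogenous b X₁ X₂ ↔ M₂.KIsogenous b X₁ X₂ := by
  unfold KIsogenous
  simp only [hfin]

/-- `IsCoreOf` only reads the flag `IsFinEt`. [cite: MochizukiAbsTopII2013, Def 3.1 (a) p.65] -/
theorem isCoreOf_iff_of_flags {M₁ M₂ : EllipticDatumModel 𝒟}
    (hfin : ∀ (b : 𝒟.Base) (X Y : (𝒟.datum b).Obj) (f : (𝒟.datum b).Hom X Y),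
      M₁.IsFinEt f ↔ M₂.IsFinEt f)
    (b : 𝒟.Base) (C X : (𝒟.datum b).Obj) : M₁.IsCoreOf b C X ↔ M₂.IsCoreOf b C X := by
  unfold IsCoreOf
  simp only [hfin, kIsogenous_iff_of_flags hfin]

/-- `doubleCoverSubgroups` only reads the flags `IsFinEt`, `IsOncePuncturedElliptic`.
[cite: MochizukiAbsTopII2013, Cor 3.3 (ii) p.68] -/
theorem doubleCoverSubgroups_eq_of_flags {M₁ M₂ : EllipticDatumModel 𝒟}
    (hfin : ∀ (b : 𝒟.Base) (X Y : (𝒟.datum b).Obj) (f : (𝒟.datum b).Hom X Y),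
      M₁.IsFinEt f ↔ M₂.IsFinEt f)
    (hell : ∀ (b : 𝒟.Base) (D : (𝒟.datum b).Obj),
      M₁.IsOncePuncturedElliptic b D ↔ M₂.IsOncePuncturedElliptic b D)
    (b : 𝒟.Base) (C : (𝒟.datum b).Obj) : M₁.doubleCoverSubgroups b C = M₂.doubleCoverSubgroups b C := by
  ext J
  unfold doubleCoverSubgroups
  simp only [Set.mem_setOf_eq, hfin, hell]

/-- **(ii′) is model-independent at a fixed datum, and does not read the cusps**: two models with
equivalent flags `IsFinEt`, `IsOncePuncturedElliptic`, `IsEllipticallyAdmissible` have EQUIVALENT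
`Cor_3_3_ii′` — abc-iut-f-067's test, passed in kernel (the frozen `Cor_3_3_ii` flips under
`doubleCovers := univ`, p429178). [cite: MochizukiAbsTopII2013, Cor 3.3 (ii) p.68] -/
theorem cor_3_3_ii'_iff_of_flags {M₁ M₂ : EllipticDatumModel 𝒟}
    (hfin : ∀ (b : 𝒟.Base) (X Y : (𝒟.datum b).Obj) (f : (𝒟.datum b).Hom X Y),
      M₁.IsFinEt f ↔ M₂.IsFinEt f)
    (hell : ∀ (b : 𝒟.Base) (D : (𝒟.datum b).Obj),
      M₁.IsOncePuncturedElliptic b D ↔ M₂.IsOncePuncturedElliptic b D)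
    (hadm : ∀ (b : 𝒟.Base) (X : (𝒟.datum b).Obj),
      M₁.IsEllipticallyAdmissible b X ↔ M₂.IsEllipticallyAdmissible b X) :
    M₁.Cor_3_3_ii' ↔ M₂.Cor_3_3_ii' := by
  unfold Cor_3_3_ii'
  refine imp_congr Iff.rfl (imp_congr Iff.rfl (forall_congr' fun b => forall_congr' fun X => ?_))
  rw [isCor33Member_iff_of_flags hadm]
  refine imp_congr Iff.rfl (forall_congr' fun C => forall_congr' fun f => ?_)
  rw [hfin, isCoreOf_iff_of_flags hfin, doubleCoverSubgroups_eq_of_flags hfin hell]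

/-! ### The double-cover subgroups of the datum are open of index `2` -/

variable (M : EllipticDatumModel 𝒟)

/-- A double-cover subgroup has index `2`. [cite: MochizukiAbsTopII2013, Cor 3.3 (ii) p.68] -/
theorem index_of_mem_doubleCoverSubgroups {b : 𝒟.Base} {C : (𝒟.datum b).Obj}
    {J : Subgroup ((𝒟.datum b).ext C).arith} (hJ : J ∈ M.doubleCoverSubgroups b C) : J.index = 2 := by
  obtain ⟨_, _, _, _, _, _, _, hidx⟩ := hJ
  exact hidx

/-- A double-cover subgroup is open (the law `isFinEt_injective`: the image of `[π₁(g)]` is open).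
[cite: MochizukiAbsTopII2013, Cor 3.3 (ii) p.68] -/
theorem isOpen_of_mem_doubleCoverSubgroups {b : 𝒟.Base} {C : (𝒟.datum b).Obj}
    {J : Subgroup ((𝒟.datum b).ext C).arith} (hJ : J ∈ M.doubleCoverSubgroups b C) :
    IsOpen (J : Set ((𝒟.datum b).ext C).arith) := by
  obtain ⟨D, g, φ, hg, -, hφ, rfl, -⟩ := hJ
  have h := (M.isFinEt_injective g hg φ hφ).2
  exact h

/-- **Reading of (ii′)**: `Cor_3_3_ii′`'s equation at a datum core is EQUIVALENT to the conjunction of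
(⊆) "for every finite étale double covering `D → C` by a once-punctured elliptic curve, `Π_D ∩ Δ_C` is
torsion-free [`D` is a scheme]" and (⊇) "every open `J ⊆ Π_C` of index `2` with `J ∩ Δ_C` torsion-free
arises from such a `D → C`". [cite: MochizukiAbsTopII2013, Cor 3.3 (ii) p.68] -/
theorem doubleCoverSubgroups_eq_iff (b : 𝒟.Base) (C : (𝒟.datum b).Obj) :
    M.doubleCoverSubgroups b C = semiEllipticDoubleCoverSubgroups ((𝒟.datum b).ext C) ↔
      (∀ J ∈ M.doubleCoverSubgroups b C, IsMulTorsionFree ↥(J ⊓ ((𝒟.datum b).ext C).geom)) ∧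
        ∀ J ∈ semiEllipticDoubleCoverSubgroups ((𝒟.datum b).ext C), J ∈ M.doubleCoverSubgroups b C := by
  constructor
  · intro h
    refine ⟨fun J hJ => ?_, fun J hJ => h ▸ hJ⟩
    rw [h] at hJ
    exact hJ.2.2
  · rintro ⟨h1, h2⟩
    ext J
    refine ⟨fun hJ => ⟨M.isOpen_of_mem_doubleCoverSubgroups hJ,
      M.index_of_mem_doubleCoverSubgroups hJ, h1 J hJ⟩, h2 J⟩

end EllipticDatumModel

end Literature.AnabelianGeometry.AbsoluteAnabelian.AbsTopII

end
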